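import Summits.CriticalPhenomena.PercolationContinuityZ3.Theorems.PercNearOneGluingNoHeavyQuantBlockCombHairRow
import HarnessLib

/-!
# QUANT lane R8, FAR on trees beyond block-combs: a block-comb plus ONE ROOT HAIR OF ARBITRARY MULTIPLICITIES — regime `μ_H ≤ cc`
# (census-2 g49's identity (A+B): two PROPER blobs), canonical form, every floor

builds on p205010 (kernel theorem, internal audit signed; external expert review pending)

Support file (`--supports stmt-CriticalPhenomena-4575`), QUANT lane census seat prim-quant-census-1 (gen 14); companion of
`…QuantBlockCombHairGeneral.lean` (regime `μ_H ≥ cc`, which needs D-root).  Canonical form as in `…QuantBlockCombHairRow.lean`: spare dead root index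
`υ` (`lv υ = 0`, `a υ = 0`), `T h = TAIL[D, q, lv, a[υ ↦ h], g[υ ↦ 1], j]`; hair = carrier of `cc ≥ 1` relays at gate `w`, pendant of `cr` relays at
private gate `u`; mean `μ_H = w·cc + w·u·cr`.

* `BlockComb.tail_ge_of_mean_hairRoot_AB` — if `μ_H ≤ cc`, the hair law `(1−w, w−wu, wu)` on `(0, cc, cc+cr)` equals
  `λ·blob(cc, g_A) ⊕ (1−λ)·blob(cc+cr, g_B)` with `g_A = μ_H/cc ∈ [w, 1]`, `g_B = μ_H/(cc+cr) ≥ wu ≥ x`, `λ = w(1−u)cc/μ_H ∈ [0,1]`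
  (ARCH-TREES-G49 §1.1 (A+B)); both components are proper block-combs with the same budget, so `BlockComb.tail_ge_of_mean` (p247138) gives
  `x ≤ (1 − w)·T 0 + w(1 − u)·T cc + w u·T (cc + cr)` for every floor `0 < x = ∏ q` below the live marginals, `x ≤ w`, `x ≤ wu`.
[cite: KozmaNitzan2024, Conjecture 3 (p. 15)] (the gluing rows served); the row is [this work] (identity: census-2 g49).
Theorems only (the `local notation3` of `…QuantBlockCombMergeModel.lean`, verbatim), no sorries, standard axioms.
-/

namespace Summit.CriticalPhenomena.PercolationContinuityZ3.Theorems

namespace Quant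

namespace BlockComb

open Finset

variable {κ : Type*} [Fintype κ] [DecidableEq κ]

/-- product-Bernoulli weight of the set `S` of open blob gates -/
local notation3 "wt[" g ", " S "]" => ∏ k, (if k ∈ (S : Finset κ) then (g : κ → ℝ) k else 1 - (g : κ → ℝ) k)
/-- probability that the chain `q` of length `D` is open exactly to depth `i` -/
local notation3 "pd[" D ", " q ", " i "]" =>
  (∏ i' ∈ Finset.range (i : ℕ), (q : ℕ → ℝ) i') * (if (i : ℕ) < (D : ℕ) then 1 - (q : ℕ → ℝ) i else 1)
/-- mass counted at depth `i` in blob configuration `S` -/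
local notation3 "mass[" lv ", " a ", " i ", " S "]" =>
  ∑ k ∈ (S : Finset κ).filter (fun k => (lv : κ → ℕ) k ≤ (i : ℕ)), ((a : κ → ℕ) k : ℕ)
/-- the tail `P(N ≥ j+1)` of the block-comb count, as an explicit finite sum -/
local notation3 "TAIL[" D ", " q ", " lv ", " a ", " g ", " j "]" =>
  ∑ i ∈ Finset.range ((D : ℕ) + 1), pd[D, q, i] *
    ∑ S : Finset κ, wt[g, S] * (if (j : ℕ) + 1 ≤ mass[lv, a, i, S] then (1 : ℝ) else 0)

/-- **Block-comb + one root hair of arbitrary multiplicities, regime `w(cc + u·cr) ≤ cc`** (census-2 g49's identity (A+B): the hair law is a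
mean-preserving mixture of the two PROPER blobs `(cc, g_A)` and `(cc + cr, g_B)`): every floor `0 < x`, no carrier condition. [this work] -/
theorem tail_ge_of_mean_hairRoot_AB (D : ℕ) (q : ℕ → ℝ) (hq : ∀ i, 0 ≤ q i ∧ q i ≤ 1) (lv : κ → ℕ) (a : κ → ℕ)
    (g : κ → ℝ) (hg : ∀ k, 0 ≤ g k ∧ g k ≤ 1) (j : ℕ) (hlv : ∀ k, 0 < a k → lv k ≤ D)
    (x : ℝ) (hx0 : 0 < x) (hxq : x = ∏ i ∈ Finset.range D, q i)
    (υ : κ) (hυ0 : lv υ = 0) (haυ : a υ = 0) (cc cr : ℕ) (hcc : 0 < cc)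
    (w u : ℝ) (hxw : x ≤ w) (hw1 : w ≤ 1) (hu : 0 ≤ u ∧ u ≤ 1) (hwu : x ≤ w * u)
    (hregime : w * cc + w * u * cr ≤ (cc : ℝ))
    (hmarg : ∀ k, 0 < a k → x ≤ (∏ i ∈ Finset.range (lv k), q i) * g k)
    (hbudget : (2 * j : ℝ) < ∑ k, (a k : ℝ) * ((∏ i ∈ Finset.range (lv k), q i) * g k) + (w * cc + w * u * cr)) :
    x ≤ (1 - w) * TAIL[D, q, lv, a, Function.update g υ 1, j] +
        w * (1 - u) * TAIL[D, q, lv, Function.update a υ cc, Function.update g υ 1, j] +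
        w * u * TAIL[D, q, lv, Function.update a υ (cc + cr), Function.update g υ 1, j] := by
  set g1 : κ → ℝ := Function.update g υ 1 with hg1def
  set T0 := TAIL[D, q, lv, a, g1, j] with hT0
  set Tc := TAIL[D, q, lv, Function.update a υ cc, g1, j] with hTc
  set Tn := TAIL[D, q, lv, Function.update a υ (cc + cr), g1, j] with hTn
  set EM : ℝ := ∑ k, (a k : ℝ) * ((∏ i ∈ Finset.range (lv k), q i) * g k) with hEM
  have hw0 : 0 < w := lt_of_lt_of_le hx0 hxw
  have hwu1 : w * u ≤ 1 := by nlinarith [hu.1, hu.2]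
  have hccR : (0 : ℝ) < cc := by exact_mod_cast hcc
  have hcrR : (0 : ℝ) ≤ cr := Nat.cast_nonneg _
  have hsum_upd : ∀ (v : ℕ) (F : κ → ℝ), ∑ k, ((Function.update a υ v k : ℕ) : ℝ) * F k = v * F υ + ∑ k, (a k : ℝ) * F k := by
    intro v F
    have h' : ∀ k, ((Function.update a υ v k : ℕ) : ℝ) * F k = (a k : ℝ) * F k + (if k = υ then (v : ℝ) * F υ else 0) := by
      intro k
      by_cases hk : k = υ
      · subst hk; rw [Function.update_self, if_pos rfl, haυ]; push_cast; ring
      · rw [Function.update_of_ne hk, if_neg hk, add_zero]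
    rw [Finset.sum_congr rfl fun k _ => h' k, Finset.sum_add_distrib, Finset.sum_ite_eq' Finset.univ υ]
    simp only [Finset.mem_univ, if_true]
    ring
  have hmargυ : (∏ i ∈ Finset.range (lv υ), q i) = 1 := by rw [hυ0]; simp
  have hrest : ∀ t : ℝ, ∑ k, (a k : ℝ) * ((∏ i ∈ Finset.range (lv k), q i) * Function.update g υ t k) = EM := by
    intro t; rw [hEM]; refine Finset.sum_congr rfl fun k _ => ?_
    by_cases hk : k = υ
    · subst hk; rw [haυ]; simp
    · rw [Function.update_of_ne hk]
  -- parameters of (A+B)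
  set μ : ℝ := w * cc + w * u * cr with hμ
  have hμ0 : 0 < μ := by rw [hμ]; nlinarith [mul_nonneg hw0.le hu.1]
  set nR : ℝ := (cc : ℝ) + cr with hnR
  have hnR0 : 0 < nR := by rw [hnR]; linarith
  set gA : ℝ := μ / cc with hgA
  set gB : ℝ := μ / nR with hgB
  set lam : ℝ := w * (1 - u) * cc / μ with hlam
  have hgA_ge : w ≤ gA := by rw [hgA, le_div_iff₀ hccR, hμ]; nlinarith [mul_nonneg hw0.le hu.1]
  have hgA_le : gA ≤ 1 := by rw [hgA, div_le_one hccR]; exact hregime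
  have hgA01 : 0 ≤ gA ∧ gA ≤ 1 := ⟨hw0.le.trans hgA_ge, hgA_le⟩
  have hgB_ge : w * u ≤ gB := by
    rw [hgB, le_div_iff₀ hnR0, hμ, hnR]
    have h1 : 0 ≤ w * cc * (1 - u) := mul_nonneg (mul_nonneg hw0.le hccR.le) (by linarith [hu.2])
    nlinarith [h1]
  have hgB_le : gB ≤ w := by
    rw [hgB, div_le_iff₀ hnR0, hμ, hnR]
    have h1 : 0 ≤ w * cr * (1 - u) := mul_nonneg (mul_nonneg hw0.le hcrR) (by linarith [hu.2])
    nlinarith [h1]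
  have hgB01 : 0 ≤ gB ∧ gB ≤ 1 := ⟨le_trans (mul_nonneg hw0.le hu.1) hgB_ge, hgB_le.trans hw1⟩
  have hlam0 : 0 ≤ lam := by rw [hlam]; exact div_nonneg (by nlinarith [hu.2, mul_nonneg hw0.le hccR.le]) hμ0.le
  have hlam1 : lam ≤ 1 := by
    rw [hlam, div_le_one hμ0, hμ]; nlinarith [mul_nonneg (mul_nonneg hw0.le hu.1) hccR.le, mul_nonneg (mul_nonneg hw0.le hu.1) hcrR]
  have hμne : μ ≠ 0 := ne_of_gt hμ0
  have hccne : (cc : ℝ) ≠ 0 := ne_of_gt hccR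
  have hnRne : nR ≠ 0 := ne_of_gt hnR0
  have c1 : lam * gA = w * (1 - u) := by rw [hlam, hgA]; field_simp
  have c2 : (1 - lam) * gB = w * u := by
    rw [hlam, hgB]; field_simp; rw [hμ, hnR]; ring
  -- generic component: a proper root blob `(v, t)` on `υ` gives `x ≤ t·T_v + (1 − t)·T 0`
  have hcomp : ∀ (v : ℕ) (t : ℝ), 0 ≤ t ∧ t ≤ 1 → x ≤ t → (v : ℝ) * t = μ →
      x ≤ t * TAIL[D, q, lv, Function.update a υ v, g1, j] + (1 - t) * T0 := by
    intro v t ht hxt hvt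
    set aV : κ → ℕ := Function.update a υ v with haV
    set gV : κ → ℝ := Function.update g υ t with hgV
    have hgV01 : ∀ k, 0 ≤ gV k ∧ gV k ≤ 1 := by
      intro k; by_cases hk : k = υ
      · subst hk; rw [hgV, Function.update_self]; exact ht
      · rw [hgV, Function.update_of_ne hk]; exact hg k
    have hlvV : ∀ k, 0 < aV k → lv k ≤ D := by
      intro k hk; by_cases hk' : k = υ
      · subst hk'; rw [hυ0]; exact Nat.zero_le _
      · rw [haV, Function.update_of_ne hk'] at hk; exact hlv k hk
    have hmargV : ∀ k, 0 < aV k → x ≤ (∏ i ∈ Finset.range (lv k), q i) * gV k := by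
      intro k hk; by_cases hk' : k = υ
      · subst hk'; rw [hmargυ, hgV, Function.update_self, one_mul]; exact hxt
      · rw [haV, Function.update_of_ne hk'] at hk; rw [hgV, Function.update_of_ne hk']; exact hmarg k hk
    have hmeanV : ∑ k, (aV k : ℝ) * ((∏ i ∈ Finset.range (lv k), q i) * gV k) = EM + μ := by
      rw [haV, hsum_upd v (fun k => (∏ i ∈ Finset.range (lv k), q i) * gV k), hmargυ, hgV, Function.update_self, one_mul, hrest t, ← hvt]
      ring
    have hbudgetV : (2 * j : ℝ) < ∑ k, (aV k : ℝ) * ((∏ i ∈ Finset.range (lv k), q i) * gV k) := by rw [hmeanV]; exact hbudget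
    have hfar := tail_ge_of_mean D q hq lv aV gV hgV01 j hlvV x hx0 hxq hmargV hbudgetV
    have heV : TAIL[D, q, lv, aV, gV, j] = t * TAIL[D, q, lv, Function.update a υ v, g1, j] + (1 - t) * T0 := by
      rw [tail_gate_split D q lv aV gV j υ]
      have h1 : gV υ = t := by rw [hgV, Function.update_self]
      have h2 : Function.update gV υ 1 = g1 := by rw [hgV, Function.update_idem]
      have h3 : Function.update aV υ 0 = a := by rw [haV, Function.update_idem]; exact Function.update_eq_self_iff.2 haυ.symm
      rw [h1, h2, h3, hgV, tail_update_dead D q lv a g j υ t haυ, hT0, hg1def, tail_update_dead D q lv a g j υ 1 haυ]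
    rw [heV] at hfar; exact hfar
  have hA := hcomp cc gA hgA01 (hxw.trans hgA_ge) (by rw [hgA]; field_simp)
  have hB := hcomp (cc + cr) gB hgB01 (hwu.trans hgB_ge) (by rw [hgB, hnR]; push_cast; field_simp)
  -- assemble: Φ = λ·(A) + (1 − λ)·(B)
  have e : lam * (gA * Tc + (1 - gA) * T0) + (1 - lam) * (gB * Tn + (1 - gB) * T0) = (1 - w) * T0 + w * (1 - u) * Tc + w * u * Tn := by
    linear_combination Tc * c1 + Tn * c2 - T0 * c1 - T0 * c2
  calc x = lam * x + (1 - lam) * x := by ring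
    _ ≤ lam * (gA * Tc + (1 - gA) * T0) + (1 - lam) * (gB * Tn + (1 - gB) * T0) :=
        add_le_add (mul_le_mul_of_nonneg_left hA hlam0) (mul_le_mul_of_nonneg_left hB (by linarith))
    _ = (1 - w) * T0 + w * (1 - u) * Tc + w * u * Tn := e

end BlockComb

end Quant

end Summit.CriticalPhenomena.PercolationContinuityZ3.Theorems
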